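/-
Origin: expansion seat `planner-pub-hodgecm-mc-glue-1-g13-0`, handover #EUAR 2026-08-21T06:09:45Z md5 ec60b66dd2be (NEW; E CARGO OF RECORD, WORDED lead 1-g87 l.15408 (F7); 80 l.; KERNEL ONLY: 1 theorem, 0 defs, 0 records ∕ cites ∕ Prop-defs; NAME LIST: HodgeCM.Model.perL_picardCM_r21AEOGISTR2DJWHHTCGUAR; ROWDEPS none in-run, imports landed; independent of #MU4; drop-alone) (`HOME/mc/pub-hodgecm-mc-glue-1-g13/stage73/HodgeCM/Model/E2InstanceOGR21AEPISTR2DJWHHTCGUAR.lean`, md5 ec60b66dd2be, 80 lines);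
landed by the gen-31 packager (p-g31) in gate run 73 as `HodgeCM/Model/E2InstanceOGR21AEPISTR2DJWHHTCGUAR.lean` (verbatim).
-/
/-
Origin: CONSTRUCTION seat `planner-pub-hodgecm-mc-glue-1-g12-0` (unit pub-hodgecm-mc-glue-1-g12, gen 12 of mc-glue-1, node E ASSEMBLER), 2026-08-21,
STAGED ON-WORD: to be tabled for the first gate run after a LEAD WORD (α-U) that follows the coordinator's answer to `HOME/S6-PROPOSAL.md`
(lead 1-g85 STATUS l.15203, spelling (O1-U)); until then NOT tabled. «UAR» = CHILD of the landed pin-side leaf «U» `HodgeCM.Model.perL_picardCM_r21AEOGISTR2DJWHHTCGU`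
(`Model/E2InstanceOGR21AEPISTR2DJWHHTCGU.lean` 37bdff08cff2, RUN 57; 5 groups `hA hGRU μ hR hΘ`) with its two CITE groups instantiated BY NAME at the vendored
kernel proofs audited in PKG: `hA := Literature.NumberTheory.Transcendental.arapura2012_cor_15_4_6_holds` and `hR := Literature.AlgebraicGeometry.HodgeTheory.deligneMilne1982_Thm_6_20_full_holds`
(AUDIT-VACUITY FINAL: HONEST) — the same two strikes that took E-old → «A» → «AR». Theorem `HodgeCM.Model.perL_picardCM_r21AEOGISTR2DJWHHTCGUAR`, 3 binder groups
`hGRU μ hΘ` (CITE `hGRU` = [GR91 Prop 3.1.1] `CompatibleSplitting` at every `cmSplittingDatum` ∕ CONSTRUCT `μ` ∕ PROVE `hΘ`); proof = ONE application of «U»;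
conclusion `(picardCMUniverse hHD hI h₁ (cmAbelianVarietyRealised_of_eigenbasis hHD hI h₃)).PerL` (= E's). Body byte-identical (from `import` on, md5 26396493f7cb) to the draft
certified lean-direct over the RUN-70 LANDED PKG oleans (`certs/pin-UAR-cert1/`: rc 0, 0 errors, 0 proof-holes, `#print axioms` = [propext, Classical.choice, Quot.sound],
`#check` = 3 groups). E of record at staging: «AR» `Model/E2InstanceOGR21AEPIAR.lean` 37bbf401e2cd — untouched by this file; whether this leaf BECOMES E is the coordinator's +
the lead's word, not this file. KERNEL ONLY: 1 theorem; 0 records, nothing cited, 0 `def … : Prop`, MODEL-N ±0 as a file; 0 proof-holes. Nothing here is a claim of the manuscripts under adjudication.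
-/
import Summits.HodgeConjecture.HodgeCM.Model.E2InstanceOGR21AEPISTR2DJWHHTCGU
import Literature.NumberTheory.Transcendental.AnalytificationMorphismsProofs
import Literature.AlgebraicGeometry.HodgeTheory.AbelianVarietyHodgeFullnessHolds

noncomputable section

open scoped TensorProduct InnerProductSpace Matrix

open Literature.NumberTheory.Automorphic Literature.NumberTheory.Weil1964
open Literature.NumberTheory.GelbartRogawski1991.UnitaryDualPair
open HodgeCM.Adelic HodgeCM.PerL34
open scoped Classical
open Literature.Geometry.ComplexHyperbolic.BallModel (U21 x₀ stabilizerEquivK21)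
open Literature.NumberTheory.Automorphic.U21 (K21 matA sclD)

/-!
# E2InstanceOGR21AEPISTR2DJWHHTCGU — THE FIVE [GR91 3.1.1] GROUPS OF THE R2 LEAF AS ONE: `hGR hGR₀ hGR₁ hGR₂ hGR₃ := SInstance.GRU.hGR∗ hGRU`

`perL_picardCM_r21AEOGISTR2DJWHHTCGU` = glue-1's #398J2HHTCG `perL_picardCM_r21AEOGISTR2DJWHHTCG` (9 groups `arapura2012_cor_15_4_6_holds hGR hGR₀ hGR₁ hGR₂ hGR₃ μ deligneMilne1982_Thm_6_20_full_holds hΘ`)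
at the five DERIVED families `@SInstance.GRU.hGR∗ hGRU` of sinst-1-g7's `Model/ThetaAdelicSideR2U.lean`, where the ONE hypothesis `hGRU` is
[GR91 Prop. 3.1.1] (`SplittingDatum.CompatibleSplitting`) at EVERY constructed CM dual-pair datum `cmSplittingDatum L e dV … dW …`, spelled out as a
closed Π-type with no data of the model in it (the abbrev `SInstance.GRU` is avoided in the binder on sinst-1-g7's measured advice: syntactic matching
at the 82 substitution sites, default heartbeats).  Every other group and the conclusion are #398J2HHTCG's with `@hGR∗` ∕ `hGR` rewritten to `(@SInstance.GRU.hGR∗ hGRU)`.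

Result: **5 binder groups `arapura2012_cor_15_4_6_holds hGRU μ deligneMilne1982_Thm_6_20_full_holds hΘ`** = CITE 3 (one group per published theorem: `arapura2012_cor_15_4_6_holds` [Arapura 2012 Cor. 15.4.6], `hGRU` [GR91 Prop. 3.1.1],
`deligneMilne1982_Thm_6_20_full_holds` [DM82 Thm 6.20]) + DATA 1 (`μ`, row 6) + PROVE 1 (`hΘ`, row 9).  Conclusion unchanged:
`(picardCMUniverse hHD hI h₁ (cmAbelianVarietyRealised_of_eigenbasis hHD hI h₃)).PerL` (4-ary universe text after the (iib-R) re-base of RUN 55).  One application, no tactic search.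
-/

namespace HodgeCM

namespace Model

open HodgeCM.Model.ArchSideTerm
open HodgeCM.Universe (AdelicThetaCore AdelicThetaCore₀ SideData ThetaModel ModelAxiomsPerL)
open Literature.AlgebraicGeometry.HodgeTheory
open Literature.AlgebraicGeometry.ComplexMultiplication (Shimura1998_Thm3_isogenousPower Shimura1998_Thm2_Cor)
open Literature.NumberTheory.Automorphic.PicardCM
open Literature.NumberTheory.Transcendental (Arapura2012_Cor_15_4_6 arapura2012_cor_15_4_6_holds)
open HodgeCM.CMTypeOps (inflate)
open HodgeCM.Model.SupplyResidual (ClassSupplyPackN)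
open HodgeCM.Model.ThetaSpace

variable (hHD : exists_isReal_hodgeModel) (hI : hodgePQ_independent_of_hodgeModel)
  (h₁ : BallQuotientUniformised)  (h₃ : CMAbelianVarietyEigenbasisRealised)

/-- **hA- AND hR-INSTANTIATED CHILD (DRAFT «UAR») of the pin-side ladder leaf «U»** (`perL_picardCM_r21AEOGISTR2DJWHHTCGU`, RUN 57; groups `hA hGRU μ hR hΘ`): `hA := arapura2012_cor_15_4_6_holds`, `hR := deligneMilne1982_Thm_6_20_full_holds` (vendored kernel proofs), ONE application of «U»; 3 explicit binder groups `hGRU μ hΘ` remain (CITE `hGRU` = [GR91 Prop 3.1.1] splitting datum ∕ CONSTRUCT `μ` ∕ PROVE `hΘ`); conclusion `Universe.PerL` of the Picard CM universe. Record-INCOMPARABLE with E = «AR» (pin side, ruling (S6) ∕ 6a). -/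
theorem perL_picardCM_r21AEOGISTR2DJWHHTCGUAR
    (hGRU : ∀ (L : Type) [Field L] [NumberField L] [NumberField.IsCMField L] {N M n : ℕ} (e : Fin N × Fin M ≃ Fin n)
      (dV : Fin N → L) (hdV : ∀ i, NumberField.IsCMField.complexConj L (dV i) = dV i) (hdV0 : ∀ i, dV i ≠ 0)
      (dW : Fin M → L) (hdW : ∀ i, NumberField.IsCMField.complexConj L (dW i) = dW i) (hdW0 : ∀ i, dW i ≠ 0),
      (cmSplittingDatum L e dV hdV hdV0 dW hdW hdW0).CompatibleSplitting)
    (μ : ∀ {L : CMField}, SeesawCtx L → Fin 4 → NumberField.InfinitePlace L → ℤ)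
    (hΘ : ∀ {L : CMField} {ι₁ : L →+* ℂ} (V : HermSpace3 L ι₁) (c : SeesawCtx L),
      (thetaModelOf hHD hI h₁ (cmAbelianVarietyRealised_of_eigenbasis hHD hI h₃) (orientBitι L ι₁) (embOf hHD hI h₁ (cmAbelianVarietyRealised_of_eigenbasis hHD hI h₃)) (coverOf hHD hI h₁ (cmAbelianVarietyRealised_of_eigenbasis hHD hI h₃) arapura2012_cor_15_4_6_holds) (wmOfInput (HypCensus.Wcm (@SInstance.GRU.hGR hGRU) (EtaChi.η (@SInstance.χVR (@SInstance.GRU.hGR hGRU) (@SInstance.GRU.hGR₀ hGRU) (@SInstance.GRU.hGR₁ hGRU)) (@SInstance.χWR (@SInstance.GRU.hGR hGRU) (@SInstance.GRU.hGR₀ hGRU) (@SInstance.GRU.hGR₁ hGRU) (ArchSideTerm.muSharp₂₃ @μ))) (EtaChi.hη (@SInstance.χVR (@SInstance.GRU.hGR hGRU) (@SInstance.GRU.hGR₀ hGRU) (@SInstance.GRU.hGR₁ hGRU)) (@SInstance.χWR (@SInstance.GRU.hGR hGRU) (@SInstance.GRU.hGR₀ hGRU) (@SInstance.GRU.hGR₁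 hGRU) (ArchSideTerm.muSharp₂₃ @μ))) (EtaChi.hηc (@SInstance.χVR (@SInstance.GRU.hGR hGRU) (@SInstance.GRU.hGR₀ hGRU) (@SInstance.GRU.hGR₁ hGRU)) (@SInstance.χWR (@SInstance.GRU.hGR hGRU) (@SInstance.GRU.hGR₀ hGRU) (@SInstance.GRU.hGR₁ hGRU) (ArchSideTerm.muSharp₂₃ @μ))))) (thetaOf _ (thetaClassInputOf _ (fun V c => thetaSpaceInputOf hHD hI h₁ (cmAbelianVarietyRealised_of_eigenbasis hHD hI h₃) (SInstance.SROGT'C (@SInstance.GRU.hGR hGRU) (@SInstance.GRU.hGR₀ hGRU) (@SInstance.GRU.hGR₁ hGRU) (@SInstance.GRU.hGR₂ hGRU) (@SInstance.GRU.hGR₃ hGRU) (ArchSideTerm.muSharp₂₃ @μ) (ArchSideTerm.hΔ₁_GOG_muSharp₂₃ (@SInstance.GRU.hGR hGRU) (@SInstance.GRU.hGR₀ hGRU) (@SInstance.GRU.hGR₁ hGRU) (@SInstance.GRU.hGR₂ hGRU) (@SInstance.GRU.hGR₃ hGRU) @μ) (ArchSideTerm.hΔ₂_GOG_muSharp₂₃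 (@SInstance.GRU.hGR hGRU) (@SInstance.GRU.hGR₀ hGRU) (@SInstance.GRU.hGR₁ hGRU) (@SInstance.GRU.hGR₂ hGRU) (@SInstance.GRU.hGR₃ hGRU) @μ (ArchSideTerm.hSV_holds (@SInstance.GRU.hGR hGRU))) (ArchSideTerm.hΔ₃_GOG_muSharp₂₃ (@SInstance.GRU.hGR hGRU) (@SInstance.GRU.hGR₀ hGRU) (@SInstance.GRU.hGR₁ hGRU) (@SInstance.GRU.hGR₂ hGRU) (@SInstance.GRU.hGR₃ hGRU) @μ (ArchSideTerm.hSV_holds (@SInstance.GRU.hGR hGRU)))) V c))) (d12Of (ArchSideTerm.muSharp₂₃ @μ)) (d34Of (ArchSideTerm.muSharp₂₃ @μ))).GoodCtx ι₁ c → Module.finrank ℚ c.K = 6 ∧ IsNormalClosure ℚ c.K L ∧ (Module.finrank ℚ L = 24 ∨ Module.finrank ℚ L = 48) →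
      (NumberField.InfinitePlace.mk ι₁).embedding = ι₁ →
      ∀ i : Fin 4, ∃ Γ₀ : Level V, ∀ Γ ≤ Γ₀,
        ∃ D : CommonReflexInput c.K (c.Ψ i) c.σ,
          (thetaModelOf hHD hI h₁ (cmAbelianVarietyRealised_of_eigenbasis hHD hI h₃) (orientBitι L ι₁) (embOf hHD hI h₁ (cmAbelianVarietyRealised_of_eigenbasis hHD hI h₃)) (coverOf hHD hI h₁ (cmAbelianVarietyRealised_of_eigenbasis hHD hI h₃) arapura2012_cor_15_4_6_holds) (wmOfInput (HypCensus.Wcm (@SInstance.GRU.hGR hGRU) (EtaChi.η (@SInstance.χVR (@SInstance.GRU.hGR hGRU) (@SInstance.GRU.hGR₀ hGRU) (@SInstance.GRU.hGR₁ hGRU)) (@SInstance.χWR (@SInstance.GRU.hGR hGRU) (@SInstance.GRU.hGR₀ hGRU) (@SInstance.GRU.hGR₁ hGRU) (ArchSideTerm.muSharp₂₃ @μ))) (EtaChi.hη (@SInstance.χVR (@SInstance.GRU.hGR hGRU) (@SInstance.GRU.hGR₀ hGRU) (@SInstance.GRU.hGR₁ hGRU)) (@SInstance.χWR (@SInstance.GRU.hGR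 hGRU) (@SInstance.GRU.hGR₀ hGRU) (@SInstance.GRU.hGR₁ hGRU) (ArchSideTerm.muSharp₂₃ @μ))) (EtaChi.hηc (@SInstance.χVR (@SInstance.GRU.hGR hGRU) (@SInstance.GRU.hGR₀ hGRU) (@SInstance.GRU.hGR₁ hGRU)) (@SInstance.χWR (@SInstance.GRU.hGR hGRU) (@SInstance.GRU.hGR₀ hGRU) (@SInstance.GRU.hGR₁ hGRU) (ArchSideTerm.muSharp₂₃ @μ))))) (thetaOf _ (thetaClassInputOf _ (fun V c => thetaSpaceInputOf hHD hI h₁ (cmAbelianVarietyRealised_of_eigenbasis hHD hI h₃) (SInstance.SROGT'C (@SInstance.GRU.hGR hGRU) (@SInstance.GRU.hGR₀ hGRU) (@SInstance.GRU.hGR₁ hGRU) (@SInstance.GRU.hGR₂ hGRU) (@SInstance.GRU.hGR₃ hGRU) (ArchSideTerm.muSharp₂₃ @μ) (ArchSideTerm.hΔ₁_GOG_muSharp₂₃ (@SInstance.GRU.hGR hGRU) (@SInstance.GRU.hGR₀ hGRU) (@SInstance.GRU.hGR₁ hGRU) (@SInstance.GRU.hGR₂ hGRU) (@SInstance.GRU.hGR₃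 hGRU) @μ) (ArchSideTerm.hΔ₂_GOG_muSharp₂₃ (@SInstance.GRU.hGR hGRU) (@SInstance.GRU.hGR₀ hGRU) (@SInstance.GRU.hGR₁ hGRU) (@SInstance.GRU.hGR₂ hGRU) (@SInstance.GRU.hGR₃ hGRU) @μ (ArchSideTerm.hSV_holds (@SInstance.GRU.hGR hGRU))) (ArchSideTerm.hΔ₃_GOG_muSharp₂₃ (@SInstance.GRU.hGR hGRU) (@SInstance.GRU.hGR₀ hGRU) (@SInstance.GRU.hGR₁ hGRU) (@SInstance.GRU.hGR₂ hGRU) (@SInstance.GRU.hGR₃ hGRU) @μ (ArchSideTerm.hSV_holds (@SInstance.GRU.hGR hGRU)))) V c))) (d12Of (ArchSideTerm.muSharp₂₃ @μ)) (d34Of (ArchSideTerm.muSharp₂₃ @μ))).Theta V c i Γ ⊆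
            Submodule.span ℂ (D.surfaceClasses hHD hI h₁ (cmAbelianVarietyRealised_of_eigenbasis hHD hI h₃) V Γ)) :
     (picardCMUniverse hHD hI h₁ (cmAbelianVarietyRealised_of_eigenbasis hHD hI h₃)).PerL
:=
  perL_picardCM_r21AEOGISTR2DJWHHTCGU hHD hI h₁ h₃ arapura2012_cor_15_4_6_holds hGRU μ deligneMilne1982_Thm_6_20_full_holds hΘ

end Model

end HodgeCM
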